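import Literature.NumberTheory.Transcendental.StableClosing
import Literature.NumberTheory.Transcendental.StdQuotients
import Literature.NumberTheory.Transcendental.StdSubgroups
import HarnessLib

/-!
# The Semistability Theorem for `M_κ` (torsion abelian part) from Philippon's zero estimate

Topic: `Literature/NumberTheory/Transcendental`. Plan item W4 (closing, final assembly) of the
unit `provefact-Literature.NumberTheory.Transcendental.H-b596640137` (fact
`Literature.NumberTheory.Transcendental.HuberWustholzOnePeriods`). Baker–Wüstholz's
Semistability Theorem (*Logarithmic Forms and Diophantine Geometry*, Thm. 6.15) for the explicit
group varieties `M_κ = 𝔾ₘ^β × P_κ`, every proper semistable `ℚ̄`-rational `𝔟`, at points with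
torsion abelian part — the general-codimension statement which is the explicit hypothesis of
`SemistableTorsion.analyticSubgroupTheorem_std_tors_of_semistable` and of
`SemistableTorsion.GaGmE.semistabilityTheorem_GaGmE_tors_of_std_tors` (formerly the named fact
`semistabilityTheorem_std_tors`; no named fact is left in `SemistableTorsion.lean` after the
D-0026 reviews recorded there) — is PROVED here modulo Philippon's zero estimate
(`PhilipponZeroEstimateStd.philippon1986_std`, Philippon 1986, Thm. 2.1, a named fact of the tree
and, after this file, the ONE named fact below `HuberWustholzOnePeriods`), by strong induction on
`n = dim M_κ`:

* if some connected algebraic subgroup `0 ≠ K₀ ≠ M_κ` is BORDERLINE for the semistable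
  `𝔟` (`dim 𝔟·(n - dim 𝔨₀) = (dim 𝔟 - dim(𝔟 ∩ 𝔨₀))·n`), the quotient `M_κ/K₀ = M_κ'`
  (`StdQuotients.QuotData.transport`) is a smaller instance; applied to ALL the division points
  `w/m` of the algebraic point `w ∈ 𝔟` it gives `w ∈ m·(ker + 𝔨₀)` for every `m ≥ 1`, whence
  `w ∈ 𝔨₀` by discreteness (`SubgroupData.mem_tangent_of_forall_exists`); then the subgroup
  `K₀ = M_κ''` (`StdSubgroups.SubData.transport`) is a smaller instance containing `w`, and the
  inductive hypothesis gives `w ∈ ker` — Baker–Wüstholz's passage to `G^*` and to `B ∩ ker π`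
  (op. cit. p. 115), here over a borderline quotient;
* if no such `K₀` exists (`𝔟` is stable), the two runs of Baker's method close the theorem
  (`StableClosing.mem_ker_of_stable`: `NumCondFamily.dichotomy'`, and in the torsion configuration
  `TorsionDichotomy.torsionDichotomy` with the division-point device of op. cit. p. 117).

PROVED: `semistabilityTheorem_std_tors_of_philippon` (every codimension), hence the hyperplane
statement for the `M_κ` at points with torsion abelian part granted Philippon's zero estimate
(`analyticSubgroupTheorem_std_tors_of_philippon`: the explicit hypothesis `hstd` of
`SemistableTorsion.GaGmE.hyperplaneTheorem_presTors_of_std_tors` and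
`SemistableTorsion.HuberWustholzOnePeriods_of_std_tors`), and through the landed reductions of
`SemistableTorsion.lean` (`GaGmE.semistabilityTheorem_GaGmE_tors_of_std_tors`,
`analyticSubgroupTheorem_GaGmE_periods_of_semistabilityTheorem_tors`)
`analyticSubgroupTheorem_GaGmE_periods_of_philippon`, `masser_of_philippon` and
**`HuberWustholzOnePeriods_of_philippon` — the seven 1-periods `1, 2πi, log α, ω₁, ω₂, η₁, η₂` are
`ℚ̄`-linearly independent granted Philippon's zero estimate on `M_κ`.** The discharge
`HuberWustholzOnePeriods_holds` is then exactly
`HuberWustholzOnePeriods_of_philippon philippon1986_std_holds` once the upstream fact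
`philippon1986_std` is proved; nothing else is assumed anywhere on the way.

## References

* A. Baker, G. Wüstholz, *Logarithmic Forms and Diophantine Geometry*, CUP 2007, Thm. 6.15, §6.8.
* A. Huber, G. Wüstholz, *Transcendence and Linear Relations of 1-Periods*, CUP 2022, Thm. 15.3(1).
* P. Philippon, *Lemmes de zéros dans les groupes algébriques commutatifs*, Bull. SMF 114 (1986), Thm. 2.1.
-/

noncomputable section

open Module Submodule Complex
open scoped PeriodPair

namespace Literature.NumberTheory.Transcendental

namespace GaGmE

namespace Std

open LiePresentation

/-- **The Semistability Theorem for `M_κ` (torsion abelian part), at dimension `n`, by strong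
induction on `n`** (modulo Philippon's zero estimate): for `Λ` with algebraic invariants and no
CM, every standard model `M_κ` of dimension `n`, every semistable proper `ℚ̄`-rational
`𝔟 ⊆ Lie M_κ` and every `w ∈ 𝔟` with `exp(w)` algebraic with torsion abelian part, `w ∈ ker(exp)`.
[cite: BakerWustholz2007, Thm. 6.15, §6.8 (p. 115: induction over G^* and B ∩ ker π; pp. 116–119)] -/
theorem mem_ker_of_semistable_card (hphil : philippon1986_std) (L : PeriodPair) (h₂ : IsAlgebraic ℚ L.g₂)
    (h₃ : IsAlgebraic ℚ L.g₃) (hCM : ¬ L.HasCM) (n : ℕ) :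
    ∀ (β γ δ : Type) [Fintype β] [Fintype γ] [Fintype δ] (κM : δ → γ → Kbar)
      (𝔟 : Submodule ℂ (β ⊕ (γ ⊕ δ) → ℂ)), Fintype.card (β ⊕ (γ ⊕ δ)) = n →
      IsKRational Kbar 𝔟 → 𝔟 ≠ ⊤ → Semistable κM 𝔟 →
      ∀ w ∈ 𝔟, w ∈ AlgTors L κM → w ∈ ker L κM := by
  induction n using Nat.strong_induction_on with
  | _ n ih =>
  intro β γ δ _ _ _ κM 𝔟 hn hrat h𝔟 hss w hw𝔟 hw
  classical
  by_cases hbord : ∃ D : SubgroupData β γ δ κM, D.tangent ≠ ⊤ ∧ D.tangent ≠ ⊥ ∧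
      finrank ℂ 𝔟 * (Fintype.card (β ⊕ (γ ⊕ δ)) - finrank ℂ D.tangent) =
        (finrank ℂ 𝔟 - finrank ℂ ↥(𝔟 ⊓ D.tangent)) * Fintype.card (β ⊕ (γ ⊕ δ))
  · -- a borderline `0 ≠ K₀ ≠ M_κ`: induct over `M_κ/K₀` and `K₀`
    obtain ⟨D₀, hD₀top, hD₀bot, hD₀bord⟩ := hbord
    have hk₀pos : 0 < finrank ℂ ↥D₀.tangent := by
      rw [Nat.pos_iff_ne_zero, Ne, Submodule.finrank_eq_zero]; exact hD₀bot
    have hk₀lt : finrank ℂ ↥D₀.tangent < n := by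
      have := Submodule.finrank_lt hD₀top; simpa [hn] using this
    -- Step 1: `w ∈ Lie K₀`, through the quotient `M_κ/K₀` at all division points `w/m`
    obtain ⟨Q⟩ := nonempty_quotData D₀
    obtain ⟨hrat', htop', hss'⟩ := Q.transport hrat h𝔟 hss hD₀top hD₀bord
    have hcard' : Fintype.card Q.σ' < n := by
      have := Q.card_eq; rw [hn] at this; omega
    have hwD₀ : w ∈ D₀.tangent := by
      refine D₀.mem_tangent_of_forall_exists (L := L) w fun m hm => ?_
      have hwm : (m : ℂ)⁻¹ • w ∈ AlgTors L κM := inv_natCast_smul_mem_AlgTors L κM h₂ h₃ hw hm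
      have hwm𝔟 : (m : ℂ)⁻¹ • w ∈ 𝔟 := Submodule.smul_mem _ _ hw𝔟
      have hΦ : Q.Φ ((m : ℂ)⁻¹ • w) ∈ ker L Q.κM' :=
        ih _ hcard' (Fin Q.nA) (Fin Q.nC) (Fin Q.nΞ) Q.κM' (𝔟.map Q.Φ) rfl hrat' htop' hss' _
          (Submodule.mem_map_of_mem hwm𝔟) (Q.Φ_mem_AlgTors h₂ h₃ hwm)
      obtain ⟨k, hk, hh⟩ := Q.exists_ker_of_Φ_mem_ker hΦ
      refine ⟨k, hk, (m : ℂ)⁻¹ • w - k, hh, ?_⟩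
      have hm0 : (m : ℂ) ≠ 0 := by exact_mod_cast hm.ne'
      rw [add_sub_cancel, smul_smul, mul_inv_cancel₀ hm0, one_smul]
    -- Step 2: transport to the subgroup `K₀ = M_κ''`
    obtain ⟨S⟩ := nonempty_subData D₀
    obtain ⟨hratS, htopS, hssS⟩ := S.transport hrat h𝔟 hss hD₀top hD₀bot hD₀bord
    have hcardS : Fintype.card S.σ' < n := by rw [S.card_eq]; exact hk₀lt
    obtain ⟨w', hw'⟩ := S.exists_eq_ι hwD₀
    have hw'𝔟 : w' ∈ 𝔟.comap S.ι := by show S.ι w' ∈ 𝔟; rw [hw']; exact hw𝔟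
    have hw'alg : w' ∈ AlgTors L S.κS := S.mem_AlgTors_of_ι h₂ h₃ (by rw [hw']; exact hw)
    have hker' := ih _ hcardS (Fin S.nA) (Fin S.nC) (Fin S.nΞ) S.κS (𝔟.comap S.ι) rfl hratS htopS hssS w' hw'𝔟 hw'alg
    rw [← hw']
    exact S.ι_mem_ker hker'
  · -- `𝔟` is stable
    push Not at hbord
    exact mem_ker_of_stable κM hphil L h₂ h₃ hCM hrat h𝔟 hss (fun D h1 h2 => hbord D h1 h2) hw𝔟 hw

end Std

end GaGmE

open GaGmE GaGmE.Std in
/-- **The Semistability Theorem for the explicit group varieties `M_κ`, every proper semistable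
`ℚ̄`-rational `𝔟`, at points with torsion abelian part, follows from Philippon's zero estimate on
`M_κ`** — exactly the explicit hypothesis of
`SemistableTorsion.analyticSubgroupTheorem_std_tors_of_semistable` (the statement of the former
named fact `semistabilityTheorem_std_tors`). [cite: BakerWustholz2007, Thm. 6.15 (Semistability Theorem), §6.8] -/
theorem semistabilityTheorem_std_tors_of_philippon (hphil : philippon1986_std) :
    ∀ (L : PeriodPair), IsAlgebraic ℚ L.g₂ → IsAlgebraic ℚ L.g₃ → ¬ L.HasCM →
      ∀ (β γ δ : Type) [Fintype β] [Fintype γ] [Fintype δ] (κM : δ → γ → Kbar)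
        (𝔟 : Submodule ℂ (β ⊕ (γ ⊕ δ) → ℂ)), LiePresentation.IsKRational Kbar 𝔟 → 𝔟 ≠ ⊤ →
        Semistable κM 𝔟 → ∀ w ∈ 𝔟, w ∈ AlgTors L κM → w ∈ ker L κM :=
  fun L h₂ h₃ hCM β γ δ _ _ _ κM 𝔟 hrat h𝔟 hss w hw𝔟 hw =>
    mem_ker_of_semistable_card hphil L h₂ h₃ hCM _ β γ δ κM 𝔟 rfl hrat h𝔟 hss w hw𝔟 hw

open GaGmE GaGmE.Std in
/-- **The hyperplane statement for the `M_κ` at points with torsion abelian part follows from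
Philippon's zero estimate on `M_κ`**: Baker–Wüstholz's Thm. 6.15 for `M_κ` and the analytic
subgroups `exp(W_ℂ)`, `W` a `ℚ̄`-rational hyperplane of `Lie M_κ` containing no non-zero algebraic
Lie subalgebra, at the algebraic points over `E^γ_tors` — equivalently the analytic subgroup theorem
(op. cit. Thm. 6.1) for these hyperplanes at such points. Such a `W` is proper
(`Std.ne_top_of_hyperplane`) and semistable (`Std.semistable_of_hyperplane`), so this is a case of
`semistabilityTheorem_std_tors_of_philippon`. The conclusion is written out: it is the explicit
hypothesis `hstd` of `SemistableTorsion.GaGmE.hyperplaneTheorem_presTors_of_std_tors`,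
`SemistableTorsion.HuberWustholzOnePeriods_of_std_tors` etc. (the statement of the former named
fact of `SemistableTorsion.lean`, merged back under D-0026; the name of this theorem is kept from
that period). [cite: BakerWustholz2007, Thm. 6.15, Thm. 6.1, §6.7] [cite: Philippon1986, Thm 2.1] -/
theorem analyticSubgroupTheorem_std_tors_of_philippon (hphil : philippon1986_std) :
    ∀ (L : PeriodPair), IsAlgebraic ℚ L.g₂ → IsAlgebraic ℚ L.g₃ → ¬ L.HasCM →
      ∀ (β γ δ : Type) [Fintype β] [Fintype γ] [Fintype δ] (κM : δ → γ → Kbar)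
        (W : Submodule ℂ (β ⊕ (γ ⊕ δ) → ℂ)), LiePresentation.IsKRational Kbar W →
        finrank ℂ W + 1 = Fintype.card (β ⊕ (γ ⊕ δ)) →
        (∀ 𝔨 ∈ algLie κM, 𝔨 ≤ W → 𝔨 = ⊥) →
        ∀ w ∈ W, w ∈ AlgTors L κM → w ∈ ker L κM :=
  fun L h₂ h₃ hCM β γ δ _ _ _ κM W hWrat hWdim hno w hwW hwAlg =>
    semistabilityTheorem_std_tors_of_philippon hphil L h₂ h₃ hCM β γ δ κM W hWrat
      (ne_top_of_hyperplane hWdim) (semistable_of_hyperplane κM hWdim hno) w hwW hwAlg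

/-- **The analytic subgroup theorem for the period point of `𝔾ₐ × 𝔾ₘ^ι × (E♮)^κ` from
Philippon's zero estimate**: the Semistability Theorem for the quotients `G/H` at points with
torsion abelian part (`GaGmE.semistabilityTheorem_GaGmE_tors_of_std_tors`, transport to the `M_κ`)
fed with `semistabilityTheorem_std_tors_of_philippon`, then the dévissage at the period vectors
(`analyticSubgroupTheorem_GaGmE_periods_of_semistabilityTheorem_tors`).
[cite: BakerWustholz2007, Thm. 6.1, Thm. 6.15, §6.8 (Thm. 6.1 from Thm. 6.15)] -/
theorem analyticSubgroupTheorem_GaGmE_periods_of_philippon (hphil : philippon1986_std) :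
    analyticSubgroupTheorem_GaGmE_periods :=
  analyticSubgroupTheorem_GaGmE_periods_of_semistabilityTheorem_tors
    fun L h₂ h₃ hCM ι κ _ _ =>
      GaGmE.semistabilityTheorem_GaGmE_tors_of_std_tors (semistabilityTheorem_std_tors_of_philippon hphil)
        L h₂ h₃ hCM ι κ

/-- **Huber–Wüstholz, elliptic–logarithmic special case, from Philippon's zero estimate**: for
`Λ` with algebraic `g₂, g₃` and no CM and an algebraic `α` that is not a root of unity, the seven
1-periods `1, 2πi, log α, ω₁, ω₂, η₁, η₂` are linearly independent over `ℚ̄` — GRANTED the named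
fact `philippon1986_std` (Philippon 1986, Thm. 2.1, for `M_κ` in the theta embedding), which is
the ONE named fact this statement rests on. Everything between Philippon's zero estimate and the
seven periods (Baker's method on `M_κ`: theta model, Siegel, extrapolation, Liouville, the two
dichotomy theorems, the induction over borderline quotients and subgroups; the transport to the
quotients `G/H` and the dévissage to the analytic subgroup theorem at the period vectors; the
computation of the minimal subgroup) is proved in the tree. The discharge
`HuberWustholzOnePeriods_holds` is `HuberWustholzOnePeriods_of_philippon philippon1986_std_holds`
once the upstream fact is proved.
[cite: HuberWustholz2022, Thm. 15.3(1) and Cor. 18.10] [cite: BakerWustholz2007, Thm. 6.15, §6.8] [cite: Philippon1986, Thm 2.1] -/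
theorem HuberWustholzOnePeriods_of_philippon (hphil : philippon1986_std) : HuberWustholzOnePeriods :=
  HuberWustholzOnePeriods_of_analyticSubgroupTheorem_periods
    (analyticSubgroupTheorem_GaGmE_periods_of_philippon hphil)

/-- **Masser's six periods `1, 2πi, ω₁, ω₂, η₁, η₂` are `ℚ̄`-linearly independent granted
Philippon's zero estimate on `M_κ`** (the seven-period statement with the auxiliary logarithm
`α = 2`, `w = log 2`). [cite: Masser1975, Ch. II Thm. II] [cite: Philippon1986, Thm 2.1] -/
theorem masser_of_philippon (hphil : philippon1986_std) : masser_ellipticPeriods := by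
  refine masser_of_huberWustholz (HuberWustholzOnePeriods_of_philippon hphil)
    ⟨2, Complex.log 2, ?_, ?_, ?_⟩
  · exact_mod_cast (isAlgebraic_nat (R := ℚ) (A := ℂ) 2)
  · intro n hn h2
    have h2' : (2 : ℕ) ^ n = 1 := by exact_mod_cast h2
    have h1 : 1 < 2 ^ n := Nat.one_lt_two_pow hn.ne'
    omega
  · exact Complex.exp_log two_ne_zero

end Literature.NumberTheory.Transcendental

end
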